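import Literature.NumberTheory.EllipticCurves.SexticTwistThetaDictionary
import Literature.NumberTheory.GaloisRepresentations.SexticResidueSymbol
import HarnessLib

/-!
# Sextic reciprocity at the inert prime `5` of `ℤ[ω]`: `ν_5(𝔞) = e((ϖ_𝔞/5)₃)`, `(5/N α) = e((α/5)₆)³`, Frobenius = conjugation

Topic `Literature/NumberTheory/EllipticCurves`, namespace `Literature.NumberTheory.EllipticCurves.SexticTwist` (sequel to
`SexticTwistThetaDictionary`).  Theorems only (no definition, no named fact).  The `j = 0` twin of
`QuarticTwistThetaDictionaryInert` (`Ψ_D = \overline{(·/q)₄}^k · Ψ'` at an inert `q ≡ 3 (4)` of `ℤ[i]`), at the prime `q = 5` — inert in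
`ℤ[ω]`, `𝓞 K3 ⧸ (5) = 𝔽₂₅` — which is the prime of the BSD programme's `j = 0` supercuspidal cell (Kodaira `II, IV, IV*, II*` for
`v₅(k) = 1, 2, 4, 5`).

For `k = 5^e k₁` with `5 ∤ k₁`, the weight `W_k(x) = 𝟙[x ≡ 1 (3)] c(N x) (k/N x) ν_{4k}((x))` of `SexticTwistThetaDictionary` factors as

  **`W_k(x) = \overline{e((x/5)₆)}^e · W_{k₁}(x)`**  (`weight_five_split`),

with `(·/5)₆ = sexticResidueSymbol (5)` the sextic residue symbol of `ℤ[ω]` at `(5)` (`GaloisRepresentations/SexticResidueSymbol`),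
`e = embC`.  The three inputs, all instances of «`(a/𝔭)₆⁻¹ = (a/𝔭)₃ (a/𝔭)₂`»:

* §1 `grossenNu_mul_left` — `ν_{DD'}(𝔞) = ν_D(𝔞) ν_{D'}(𝔞)` on `(𝔞, 3DD') = 1` (prime by prime `χ_𝔭(DD') = χ_𝔭(D)χ_𝔭(D')`, then unique
  factorisation of ideals); ★ `psi_five_eq_cubicResidueSymbol_primGen` — **cubic reciprocity for the rational prime `5`**:
  `ν_5(𝔞) = e((ϖ_𝔞/5)₃)` for `(𝔞, 15) = 1` (prime by prime Ireland–Rosen Ch. 9 §4: `χ_𝔭(5) = χ_{(5)}(J(χ_𝔭, χ_𝔭))` — the tree's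
  `cubicResidueSymbol_natCast_eq_cubicResidueSymbol_cubicJacobiSum` — and `J(χ_𝔭, χ_𝔭) = −ϖ_𝔭`, `cubicJacobiSum_eq_neg_of_span_eq`);
* §2 the residue field `𝔽₂₅ = 𝓞 K3 ⧸ (5)`: Frobenius is complex conjugation (`mk_pow_five_eq_mk_tau`), `N(α) ≡ α⁶`, hence
  ★ `jacobiSym_five_absNorm_eq` — **`(5/N α) = (N α/5) = e((α/5)₆)³`** (quadratic reciprocity for the Jacobi symbol and Euler's criterion
  `(α/5)₆³ ≡ α¹²`); `embC_sexticResidueSymbol_tau` — `e((τα/5)₆) = \overline{e((α/5)₆)}`;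
* §3 (sequel `SexticTwistThetaDictionaryInert`) `weight_five_split` and, in the `ℤ²`-coordinates of `QuadOrder` (`γ = y₁ + y₂ω₃ = y₂ρ + (y₁ + y₂)`, `γ = \overline{e(x)}`),
  `thetaWeight_five_split` — `Φ_k(y) = Φ₅(y₂, y₁ + y₂) · Φ_{k₁}(y)` with `Φ₅(c₁, c₂) = e(((c₁ρ + c₂)/5)₆)^e` on `(ℤ/5)²`, multiplicative,
  `Φ₅(0) = 0`, `Φ₅(1 − ρ) = Φ₅(−1, 1) = (−ρ²)^e`;
* §4 (sequel) ★ `lSeries_twist_eq_thetaLFunction_five` — the dictionary of `SexticTwistThetaDictionary` re-levelled at `5 · M′`, `M′ = 36|k₁|m`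
  prime to `5`, with the coefficient in the split form `Φ₅(y₂, y₁ + y₂) · Ψ(y)`, `Ψ = Φ_{k₁}` periodic modulo `M′` with algebraic-integer values
  — the `hdict` input of the BED assembly (`Summits/BirchSwinnertonDyer`, crux `ManinDatumSupercuspidalCMInert`, stub `S5`).

Nothing about BSD is proved here.

## References
* K. Ireland, M. Rosen, *A Classical Introduction to Modern Number Theory*, 2nd ed., GTM 84 (1990), Ch. 9 §3 Theorem 1 and §4
  (proof, case `π₁ = q ≡ 2 (3)`), Ch. 14 §2 (power residue symbol), Ch. 18 §7. [IrelandRosen1990] [IrelandRosen1982]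
* E. Hecke, *Eine neue Art von Zetafunktionen …* II, Math. Z. 6 (1920), §9. [Hecke1920]

## Mathlib / tree search
Tree: `SexticTwist.{weight_periodic, isIntegral_weight, sum_normEq_weight_eq, lSeries_coeff_parityLift, odd_absNorm_of_adm}` (prequel);
`EisensteinGrossen.{grossenNu_apply, psi_mul, psi_top, psi_asIdeal_eq, adm_mul_iff, Adm.coprime_three, primGen_mul, primGen_top,
span_primGen, primGen_sub_one_mem, primGen_span_singleton, primGen_eq_of, embC_tau, tau, tau_mkInt, coe_tau, hζ, three, mem_primesOver,
primeOf, absNorm_span_natCast, intCast_not_mem}`, `K3.{mkInt, mkInt_mul, mkInt_mul_conj, asIdeal_eq_of_mod_three_eq_two,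
prime_natCast_of_mod_three_eq_two, intCast_dvd_mkInt_iff, zetaInt}`; `cubicResidueSymbol_mul/_spec/_zero`,
`cubicResidueSymbol_natCast_eq_cubicResidueSymbol_cubicJacobiSum`, `cubicJacobiSum_eq_neg_of_span_eq`, `charP_quotient_of_natCast_mem`;
`sexticResidueSymbol_{spec, eq_of_pow_six_eq_one, zero, mul, sq}`, `mk_sexticResidueSymbol_pow_three`, `sexticResidueSymbol_pow_three_eq_one_or`,
`isPrimitiveRoot_neg_of_isPrimitiveRoot_three`.  Mathlib: `UniqueFactorizationMonoid.induction_on_prime`, `jacobiSym.mul_left/pow_left`,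
`jacobiSym.quadratic_reciprocity_one_mod_four`, `legendreSym.to_jacobiSym/eq_pow/eq_one_or_neg_one`, `ZMod.castHom`, `ZMod.pow_card`,
`add_pow_char`, `Ideal.quotientMap`, `UpperHalfPlane.ρ`.
-/

noncomputable section

open scoped Classical ComplexConjugate

open NumberField IsDedekindDomain Finset Complex
open Literature.NumberTheory.NumberFields Literature.NumberTheory.NumberFields.K3
open Literature.NumberTheory.GaloisRepresentations
open Literature.NumberTheory.LFunctions Literature.NumberTheory.LFunctions.NumberField
open Literature.NumberTheory.LFunctions.EisensteinGrossen Literature.NumberTheory.LFunctions.PlaneLattice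

namespace Literature.NumberTheory.EllipticCurves

namespace SexticTwist

/-! ### §1 `ν_{DD'} = ν_D ν_{D'}` and cubic reciprocity for the rational prime `5` in Artin-symbol form -/

section Ideals

/-- From admissibility for `D` at a prime `v`: `3 ∉ v` and `D ∉ v`. [cite: IrelandRosen1990, Ch. 9 §3 Prop. 9.3.3] -/
theorem not_mem_of_adm {D : 𝓞 K3} {v : HeightOneSpectrum (𝓞 K3)} (h : Adm D v.asIdeal) :
    (3 : 𝓞 K3) ∉ v.asIdeal ∧ D ∉ v.asIdeal := by
  have key : ∀ x : 𝓞 K3, x ∣ 3 * D → x ∉ v.asIdeal := by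
    intro x hx hxv
    have hcop := h.2
    rw [Ideal.isCoprime_iff_sup_eq] at hcop
    have hle : v.asIdeal ⊔ Ideal.span {3 * D} ≤ v.asIdeal :=
      sup_le le_rfl ((Ideal.span_singleton_le_iff_mem _).mpr (Ideal.mem_of_dvd _ hx hxv))
    rw [hcop, top_le_iff] at hle
    exact v.isPrime.ne_top hle
  exact ⟨key 3 (dvd_mul_right 3 D), key D (dvd_mul_left D 3)⟩

/-- Admissibility for a product of parameters gives admissibility for each factor. [cite: IrelandRosen1990, Ch. 9 §3 Prop. 9.3.3] -/
theorem adm_of_adm_mul_left {D D' : 𝓞 K3} {I : Ideal (𝓞 K3)} (h : Adm (D * D') I) : Adm D I ∧ Adm D' I := by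
  obtain ⟨hI0, hcop⟩ := h
  have e1 : Ideal.span {3 * (D * D')} = Ideal.span {3 * D} * Ideal.span {D'} := by
    rw [Ideal.span_singleton_mul_span_singleton]; ring_nf
  have e2 : Ideal.span {3 * (D * D')} = Ideal.span {3 * D'} * Ideal.span {D} := by
    rw [Ideal.span_singleton_mul_span_singleton]; ring_nf
  refine ⟨⟨hI0, ?_⟩, ⟨hI0, ?_⟩⟩
  · rw [e1] at hcop; exact hcop.of_mul_right_left
  · rw [e2] at hcop; exact hcop.of_mul_right_left

/-- **Multiplicativity in the parameter**: `ν_{DD'}(𝔞) = ν_D(𝔞) · ν_{D'}(𝔞)` for `𝔞` prime to `3DD'` (at primes `χ_𝔭(DD') = χ_𝔭(D)χ_𝔭(D')`,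
then unique factorisation). [cite: IrelandRosen1990, Ch. 9 §3 Prop. 9.3.3 (b)] -/
theorem grossenNu_mul_left (D D' : 𝓞 K3) (I : Ideal (𝓞 K3)) (h : Adm (D * D') I) :
    grossenNu (D * D') 1 0 I = grossenNu D 1 0 I * grossenNu D' 1 0 I := by
  induction I using UniqueFactorizationMonoid.induction_on_prime with
  | h₁ => exact absurd rfl h.1
  | h₂ J hJ =>
    rw [Ideal.isUnit_iff.mp hJ, ← Ideal.one_eq_top, map_one, map_one, map_one, mul_one]
  | h₃ J P hJ0 hP ih =>
    have hPJ := (adm_mul_iff (D * D')).mp h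
    obtain ⟨hP', hJ'⟩ := hPJ
    rw [map_mul, map_mul, map_mul, ih hJ']
    -- the prime factor
    have hPne : P ≠ ⊥ := hP.ne_zero
    set v : HeightOneSpectrum (𝓞 K3) := ⟨P, Ideal.isPrime_of_prime hP, hPne⟩ with hv
    have hvP : v.asIdeal = P := rfl
    rw [← hvP] at hP' ⊢
    obtain ⟨hD, hD'⟩ := adm_of_adm_mul_left hP'
    obtain ⟨h3, hDD'⟩ := not_mem_of_adm hP'
    have hDv : D ∉ v.asIdeal := (not_mem_of_adm hD).2
    have hD'v : D' ∉ v.asIdeal := (not_mem_of_adm hD').2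
    have hv_eq : grossenNu (D * D') 1 0 v.asIdeal = grossenNu D 1 0 v.asIdeal * grossenNu D' 1 0 v.asIdeal := by
      rw [grossenNu_apply, if_pos hP', grossenNu_apply, if_pos hD, grossenNu_apply, if_pos hD', psi_asIdeal_eq _ v hDD' h3,
        psi_asIdeal_eq _ v hDv h3, psi_asIdeal_eq _ v hD'v h3, map_mul (Ideal.Quotient.mk v.asIdeal) D D',
        cubicResidueSymbol_mul EisensteinGrossen.hζ]
      simp only [pow_one, sectorWeight, pow_zero, mul_one]
      push_cast
      rw [map_mul]
    rw [hv_eq]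
    ring

/-- `Adm D 𝔞 ⟹ Adm (D^(e+1)) 𝔞`. [cite: IrelandRosen1990, Ch. 9 §3 Prop. 9.3.3] -/
theorem adm_pow_of_adm {D : 𝓞 K3} {I : Ideal (𝓞 K3)} (h : Adm D I) (e : ℕ) : Adm (D ^ (e + 1)) I := by
  refine ⟨h.1, ?_⟩
  have hcop := h.2
  have h3 : IsCoprime I (Ideal.span {(3 : 𝓞 K3)}) := by
    rw [show Ideal.span {3 * D} = Ideal.span {(3 : 𝓞 K3)} * Ideal.span {D} from
      (Ideal.span_singleton_mul_span_singleton _ _).symm] at hcop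
    exact hcop.of_mul_right_left
  have hD : IsCoprime I (Ideal.span {D}) := by
    rw [show Ideal.span {3 * D} = Ideal.span {(3 : 𝓞 K3)} * Ideal.span {D} from
      (Ideal.span_singleton_mul_span_singleton _ _).symm] at hcop
    exact hcop.of_mul_right_right
  rw [show Ideal.span {3 * D ^ (e + 1)} = Ideal.span {(3 : 𝓞 K3)} * Ideal.span {D} ^ (e + 1) by
    rw [Ideal.span_singleton_pow, Ideal.span_singleton_mul_span_singleton]]
  exact IsCoprime.mul_right h3 (IsCoprime.pow_right hD)

/-- `ν_{D^e}(𝔞) = ν_D(𝔞)^e` for `𝔞` prime to `3D`, `e ≥ 1`. [cite: IrelandRosen1990, Ch. 9 §3 Prop. 9.3.3 (b)] -/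
theorem grossenNu_pow_left (D : 𝓞 K3) (I : Ideal (𝓞 K3)) (h : Adm D I) (e : ℕ) :
    grossenNu (D ^ (e + 1)) 1 0 I = grossenNu D 1 0 I ^ (e + 1) := by
  induction e with
  | zero => rw [zero_add, pow_one, pow_one]
  | succ e ih =>
    rw [pow_succ, grossenNu_mul_left _ _ _ (by rw [← pow_succ]; exact adm_pow_of_adm h (e + 1)), ih, ← pow_succ]

/-- The prime `(5)` of `𝓞 K3` has residue field of order `25`. [cite: IrelandRosen1990, Ch. 9 §1 Prop. 9.1.4] -/
theorem residueCard_eq_of_five_mem {v : HeightOneSpectrum (𝓞 K3)} (hv : ((5 : ℤ) : 𝓞 K3) ∈ v.asIdeal) :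
    v.residueCard = 5 ^ 2 := by
  have h := asIdeal_eq_of_mod_three_eq_two (by norm_num : Nat.Prime 5) (by norm_num) v hv
  show Ideal.absNorm v.asIdeal = 5 ^ 2
  rw [h]; exact EisensteinGrossen.absNorm_span_natCast 5

/-- `2, 3 ∉ (5)` in `𝓞 K3`. [cite: IrelandRosen1990, Ch. 9 §1 Prop. 9.1.4] -/
theorem two_three_not_mem_of_five_mem {v : HeightOneSpectrum (𝓞 K3)} (hv : ((5 : ℤ) : 𝓞 K3) ∈ v.asIdeal) :
    (2 : 𝓞 K3) ∉ v.asIdeal ∧ (3 : 𝓞 K3) ∉ v.asIdeal := by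
  have h2 := intCast_not_mem (by norm_num : Nat.Prime 5) hv (n := 2) (by norm_num)
  have h3 := intCast_not_mem (by norm_num : Nat.Prime 5) hv (n := 3) (by norm_num)
  push_cast at h2 h3
  exact ⟨h2, h3⟩

/-- A cubic residue symbol takes the value `1` at `−1` (`χ(−1)² = χ(1) = 1`, `χ(−1)³ = 1`). [cite: IrelandRosen1990, Ch. 9 §3 Prop. 9.3.3] -/
theorem cubicResidueSymbol_neg_one {v : HeightOneSpectrum (𝓞 K3)} (h3 : (3 : 𝓞 K3) ∉ v.asIdeal) :
    cubicResidueSymbol v (-1 : 𝓞 K3 ⧸ v.asIdeal) = 1 := by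
  letI := Ideal.Quotient.field v.asIdeal
  set x := cubicResidueSymbol v (-1 : 𝓞 K3 ⧸ v.asIdeal) with hx
  have h2 : x * x = 1 := by
    rw [hx, ← cubicResidueSymbol_mul EisensteinGrossen.hζ, neg_one_mul, neg_neg, cubicResidueSymbol_one EisensteinGrossen.hζ h3]
  have hcube : x ^ 3 = 1 := (cubicResidueSymbol_spec EisensteinGrossen.hζ h3 (neg_ne_zero.mpr one_ne_zero)).1
  rw [pow_succ, pow_two, h2, one_mul] at hcube
  exact hcube

/-- ★ **Cubic reciprocity for the rational prime `5`, Artin-symbol form: `ν_5(𝔞) = e((ϖ_𝔞 / 5)₃)`** for every ideal `𝔞` of `ℤ[ω]` prime to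
`15`, `ϖ_𝔞 ≡ 1 (3)` its primary generator (at a prime `𝔭 ∤ 15`: `ν_5(𝔭) = e(χ_𝔭(5))` and `χ_𝔭(5) = χ_{(5)}(J(χ_𝔭, χ_𝔭)) = χ_{(5)}(−ϖ_𝔭) = χ_{(5)}(ϖ_𝔭)`
— Ireland–Rosen's «`χ_π(q) = χ_q(π)`» for `q = 5`; both sides are multiplicative in `𝔞`).
[cite: IrelandRosen1990, Ch. 9 §3 Theorem 1 and §4 (proof, case `π₁ = q ≡ 2 (3)`)] -/
theorem psi_five_eq_cubicResidueSymbol_primGen {v₅ : HeightOneSpectrum (𝓞 K3)} (hv : ((5 : ℤ) : 𝓞 K3) ∈ v₅.asIdeal)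
    (I : Ideal (𝓞 K3)) (h : Adm ((5 : ℤ) : 𝓞 K3) I) :
    ((psi ((5 : ℤ) : 𝓞 K3) I : ℂˣ) : ℂ) = embC ((cubicResidueSymbol v₅ (Ideal.Quotient.mk v₅.asIdeal (primGen I)) : 𝓞 K3) : K3) := by
  obtain ⟨h2₅, h3₅⟩ := two_three_not_mem_of_five_mem hv
  have hv5 : ((5 : ℕ) : 𝓞 K3) ∈ v₅.asIdeal := by have h := hv; rw [Int.cast_ofNat] at h; rwa [Nat.cast_ofNat]
  have hcard := residueCard_eq_of_five_mem hv
  induction I using UniqueFactorizationMonoid.induction_on_prime with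
  | h₁ => exact absurd rfl h.1
  | h₂ J hJ =>
    rw [Ideal.isUnit_iff.mp hJ, psi_top, primGen_top, map_one, cubicResidueSymbol_one EisensteinGrossen.hζ h3₅]
    simp
  | h₃ J P hJ0 hP ih =>
    obtain ⟨hP', hJ'⟩ := (adm_mul_iff ((5 : ℤ) : 𝓞 K3)).mp h
    have hPne : P ≠ ⊥ := hP.ne_zero
    set v : HeightOneSpectrum (𝓞 K3) := ⟨P, Ideal.isPrime_of_prime hP, hPne⟩ with hvdef
    have hvP : v.asIdeal = P := rfl
    rw [← hvP] at hP' ⊢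
    obtain ⟨h3, h5⟩ := not_mem_of_adm hP'
    have h5' : ((5 : ℕ) : 𝓞 K3) ∉ v.asIdeal := by have h := h5; rw [Int.cast_ofNat] at h; rwa [Nat.cast_ofNat]
    -- the prime step: `χ_v(5) = χ_{(5)}(ϖ_v)`
    have hrec := cubicResidueSymbol_natCast_eq_cubicResidueSymbol_cubicJacobiSum EisensteinGrossen.hζ (q := 5) (by norm_num)
      hv5 hcard h3 h5'
    have hJ : cubicJacobiSum EisensteinGrossen.hζ v h3 = -primGen v.asIdeal :=
      cubicJacobiSum_eq_neg_of_span_eq EisensteinGrossen.hζ v h3 (span_primGen hP'.coprime_three) (primGen_sub_one_mem hP'.coprime_three)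
    have hcast : (Ideal.Quotient.mk v.asIdeal ((5 : ℤ) : 𝓞 K3)) = ((5 : ℕ) : 𝓞 K3 ⧸ v.asIdeal) := by
      rw [map_intCast]; rfl
    have hneg : Ideal.Quotient.mk v₅.asIdeal (-primGen v.asIdeal) = (-1) * Ideal.Quotient.mk v₅.asIdeal (primGen v.asIdeal) := by
      rw [map_neg (Ideal.Quotient.mk v₅.asIdeal) (primGen v.asIdeal), neg_one_mul]
    have hprime : ((psi ((5 : ℤ) : 𝓞 K3) v.asIdeal : ℂˣ) : ℂ) =
        embC ((cubicResidueSymbol v₅ (Ideal.Quotient.mk v₅.asIdeal (primGen v.asIdeal)) : 𝓞 K3) : K3) := by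
      rw [psi_asIdeal_eq _ v h5 h3, hcast, hrec, hJ, hneg, cubicResidueSymbol_mul EisensteinGrossen.hζ,
        cubicResidueSymbol_neg_one h3₅, one_mul]
    rw [psi_mul _ hPne hJ0, Units.val_mul, ih hJ', primGen_mul hP'.coprime_three hJ'.coprime_three, map_mul,
      cubicResidueSymbol_mul EisensteinGrossen.hζ, hvP, hprime]
    push_cast
    rw [map_mul]

end Ideals

/-! ### §2 The residue field `𝔽₂₅ = 𝓞 K3 ⧸ (5)`: Frobenius = conjugation, `(5/N α) = e((α/5)₆)³`, `(τα/5)₆ = τ((α/5)₆)` -/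

section Five

variable {v₅ : HeightOneSpectrum (𝓞 K3)} (hv : ((5 : ℤ) : 𝓞 K3) ∈ v₅.asIdeal)
include hv

omit hv in
/-- `ζ² = −1 − ζ` in `𝓞 K3`. [cite: IrelandRosen1990, Ch. 9 §1] -/
theorem zetaInt_sq : (zetaInt : 𝓞 K3) ^ 2 = -1 - zetaInt := by
  apply RingOfIntegers.ext
  push_cast
  simp only [coe_zetaInt]
  exact zeta_sq

omit hv in
/-- `a + bζ = mkInt a b`. [cite: IrelandRosen1990, Ch. 9 §1] -/
theorem intCast_add_mul_zetaInt (a b : ℤ) : (a : 𝓞 K3) + (b : 𝓞 K3) * zetaInt = mkInt a b := by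
  rw [zetaInt_eq, ← mkInt_intCast, ← mkInt_intCast, mkInt_mul, mkInt_add]
  congr 1 <;> ring

/-- The residue ring at `(5)` has characteristic `5`. [cite: IrelandRosen1990, Ch. 9 §1 Prop. 9.1.4] -/
theorem charP_five : CharP (𝓞 K3 ⧸ v₅.asIdeal) 5 := by
  haveI : Fact (Nat.Prime 5) := ⟨by norm_num⟩
  exact charP_quotient_of_natCast_mem (K := K3) (by have h := hv; rw [Int.cast_ofNat] at h; rwa [Nat.cast_ofNat])

/-- **Frobenius at the inert prime `5` is complex conjugation**: `α⁵ ≡ τ(α) (mod 5)` (`(a + bζ)⁵ ≡ a + bζ⁵ = a + bζ²`).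
[cite: IrelandRosen1990, Ch. 9 §1 Prop. 9.1.4; Ch. 14 §2] -/
theorem mk_pow_five_eq_mk_tau (α : 𝓞 K3) :
    (Ideal.Quotient.mk v₅.asIdeal α) ^ 5 = Ideal.Quotient.mk v₅.asIdeal (tau α) := by
  haveI : Fact (Nat.Prime 5) := ⟨by norm_num⟩
  haveI := charP_five hv
  obtain ⟨a, b, rfl⟩ := exists_eq_mkInt α
  have h5 : Ideal.Quotient.mk v₅.asIdeal (5 : 𝓞 K3) = 0 := by
    have h := hv
    rw [Int.cast_ofNat] at h
    exact Ideal.Quotient.eq_zero_iff_mem.mpr h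
  have hint : ∀ n : ℤ, (Ideal.Quotient.mk v₅.asIdeal (n : 𝓞 K3)) ^ 5 = Ideal.Quotient.mk v₅.asIdeal (n : 𝓞 K3) := by
    intro n
    have hdiv : (5 : ℤ) ∣ n ^ 5 - n := by
      refine (ZMod.intCast_zmod_eq_zero_iff_dvd (n ^ 5 - n) 5).mp ?_
      rw [Int.cast_sub, Int.cast_pow, ZMod.pow_card, sub_self]
    obtain ⟨t, ht⟩ := hdiv
    have hn5 : n ^ 5 = 5 * t + n := by linear_combination ht
    calc (Ideal.Quotient.mk v₅.asIdeal (n : 𝓞 K3)) ^ 5 = Ideal.Quotient.mk v₅.asIdeal (((n ^ 5 : ℤ)) : 𝓞 K3) := by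
          rw [← map_pow, Int.cast_pow]
      _ = Ideal.Quotient.mk v₅.asIdeal (n : 𝓞 K3) := by
          rw [hn5, Int.cast_add, Int.cast_mul, Int.cast_ofNat, map_add (Ideal.Quotient.mk v₅.asIdeal),
            map_mul (Ideal.Quotient.mk v₅.asIdeal), h5, zero_mul, zero_add]
  have hz3 : Ideal.Quotient.mk v₅.asIdeal zetaInt ^ 3 = 1 := by rw [← map_pow, EisensteinGrossen.hζ.pow_eq_one, map_one]
  have hz2 : Ideal.Quotient.mk v₅.asIdeal zetaInt ^ 2 = -1 - Ideal.Quotient.mk v₅.asIdeal zetaInt := by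
    rw [← map_pow, zetaInt_sq, map_sub, map_neg, map_one]
  rw [tau_mkInt, ← intCast_add_mul_zetaInt, ← intCast_add_mul_zetaInt, map_add, map_mul, map_add, map_mul, add_pow_char, mul_pow,
    hint, hint, show Ideal.Quotient.mk v₅.asIdeal zetaInt ^ 5 = Ideal.Quotient.mk v₅.asIdeal zetaInt ^ 3 *
      Ideal.Quotient.mk v₅.asIdeal zetaInt ^ 2 by ring, hz3, one_mul, hz2, Int.cast_neg, Int.cast_sub, map_neg, map_sub]
  ring

/-- `5 ∣ τα ↔ 5 ∣ α`: the prime `(5)` is stable under conjugation. [cite: IrelandRosen1990, Ch. 9 §1 Prop. 9.1.4] -/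
theorem tau_mem_iff (α : 𝓞 K3) : tau α ∈ v₅.asIdeal ↔ α ∈ v₅.asIdeal := by
  have h5 : v₅.asIdeal = Ideal.span {((5 : ℤ) : 𝓞 K3)} :=
    asIdeal_eq_of_mod_three_eq_two (by norm_num : Nat.Prime 5) (by norm_num) v₅ hv
  have key : ∀ β : 𝓞 K3, β ∈ v₅.asIdeal → tau β ∈ v₅.asIdeal := by
    intro β hβ
    rw [h5, Ideal.mem_span_singleton] at hβ ⊢
    obtain ⟨c, rfl⟩ := hβ
    exact ⟨tau c, by rw [map_mul, tau_intCast]⟩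
  refine ⟨fun h ↦ ?_, key α⟩
  have := key _ h
  rwa [tau_tau] at this

/-- **`N(α) ≡ α⁶ (mod 5)`** (`N(α) = α τ(α)` and `τ(α) ≡ α⁵`). [cite: IrelandRosen1990, Ch. 9 §1 Prop. 9.1.4] -/
theorem mk_absNorm_eq_pow_six (α : 𝓞 K3) :
    (Ideal.Quotient.mk v₅.asIdeal ((Ideal.absNorm (Ideal.span {α}) : ℕ) : 𝓞 K3)) = (Ideal.Quotient.mk v₅.asIdeal α) ^ 6 := by
  obtain ⟨a, b, rfl⟩ := exists_eq_mkInt α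
  have hN : ((Ideal.absNorm (Ideal.span {mkInt a b}) : ℕ) : 𝓞 K3) = mkInt a b * tau (mkInt a b) := by
    rw [tau_mkInt, mkInt_mul_conj, show ((Ideal.absNorm (Ideal.span {mkInt a b}) : ℕ) : 𝓞 K3) =
      (((Ideal.absNorm (Ideal.span {mkInt a b}) : ℕ) : ℤ) : 𝓞 K3) by push_cast; rfl, absNorm_span_mkInt_cast]
  rw [hN, map_mul, ← mk_pow_five_eq_mk_tau hv]
  ring

/-- An element with `5 ∤ α` has norm prime to `5`. [cite: IrelandRosen1990, Ch. 9 §1 Prop. 9.1.4] -/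
theorem not_five_dvd_absNorm {α : 𝓞 K3} (hα : α ∉ v₅.asIdeal) : ¬ (5 : ℤ) ∣ (Ideal.absNorm (Ideal.span {α}) : ℕ) := by
  intro h
  haveI := charP_five hv
  have h0 : (Ideal.Quotient.mk v₅.asIdeal ((Ideal.absNorm (Ideal.span {α}) : ℕ) : 𝓞 K3)) = 0 := by
    obtain ⟨t, ht⟩ := h
    have : ((Ideal.absNorm (Ideal.span {α}) : ℕ) : 𝓞 K3) = (((Ideal.absNorm (Ideal.span {α}) : ℕ) : ℤ) : 𝓞 K3) := by
      push_cast; rfl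
    rw [this, ht, Int.cast_mul, map_mul, map_intCast,
      show ((5 : ℤ) : 𝓞 K3 ⧸ v₅.asIdeal) = ((5 : ℕ) : 𝓞 K3 ⧸ v₅.asIdeal) by push_cast; rfl, CharP.cast_eq_zero, zero_mul]
  rw [mk_absNorm_eq_pow_six hv] at h0
  letI := Ideal.Quotient.field v₅.asIdeal
  exact hα (Ideal.Quotient.eq_zero_iff_mem.mp (pow_eq_zero_iff (by norm_num) |>.mp h0))

/-- ★ **`(5/N α) = e((α/5)₆)³`** for `α ∈ ℤ[ω]` with `5 ∤ α` and odd norm: quadratic reciprocity `(5/N α) = (N α/5)` for the Jacobi symbol,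
Euler's criterion `(N α/5) ≡ (N α)² (mod 5)`, `N α ≡ α⁶` and `(α/5)₆³ ≡ α¹² (mod 5)`, both sides `±1`.
[cite: IrelandRosen1982, Ch. 14 §2, Prop. 14.2.2] [cite: IrelandRosen1990, Ch. 5 §2 Theorem 1 (quadratic reciprocity)] -/
theorem jacobiSym_five_absNorm_eq {α : 𝓞 K3} (hα : α ∉ v₅.asIdeal) (hodd : Odd (Ideal.absNorm (Ideal.span {α}))) :
    (jacobiSym 5 (Ideal.absNorm (Ideal.span {α})) : ℂ) =
      embC ((sexticResidueSymbol v₅ (Ideal.Quotient.mk v₅.asIdeal α) : 𝓞 K3) : K3) ^ 3 := by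
  haveI : Fact (Nat.Prime 5) := ⟨by norm_num⟩
  haveI := charP_five hv
  letI := Ideal.Quotient.field v₅.asIdeal
  have hζ6 := isPrimitiveRoot_neg_of_isPrimitiveRoot_three EisensteinGrossen.hζ
  obtain ⟨h2₅, h3₅⟩ := two_three_not_mem_of_five_mem hv
  set n : ℕ := Ideal.absNorm (Ideal.span {α}) with hn
  have hα0 : Ideal.Quotient.mk v₅.asIdeal α ≠ 0 := fun h ↦ hα (Ideal.Quotient.eq_zero_iff_mem.mp h)
  -- `(5/n) = (n/5) = legendreSym 5 n`
  have hQR : jacobiSym 5 n = legendreSym 5 n := by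
    rw [jacobiSym.legendreSym.to_jacobiSym]
    exact jacobiSym.quadratic_reciprocity_one_mod_four (a := 5) (b := n) (by norm_num) hodd
  -- Euler's criterion read in `𝓞 K3 ⧸ (5)`: `legendreSym 5 n ≡ n² ≡ α¹²`
  have hn5 : ((n : ℤ) : ZMod 5) ≠ 0 := by
    rw [Ne, ZMod.intCast_zmod_eq_zero_iff_dvd]
    exact not_five_dvd_absNorm hv hα
  have hE : Ideal.Quotient.mk v₅.asIdeal ((legendreSym 5 n : ℤ) : 𝓞 K3) = Ideal.Quotient.mk v₅.asIdeal α ^ 12 := by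
    have h1 : Ideal.Quotient.mk v₅.asIdeal ((legendreSym 5 n : ℤ) : 𝓞 K3) =
        ZMod.castHom (dvd_refl 5) (𝓞 K3 ⧸ v₅.asIdeal) (legendreSym 5 n : ZMod 5) := by
      rw [map_intCast, map_intCast]
    have h2 : ((n : ℤ) : 𝓞 K3 ⧸ v₅.asIdeal) = Ideal.Quotient.mk v₅.asIdeal ((n : ℕ) : 𝓞 K3) := by
      rw [map_natCast, Int.cast_natCast]
    rw [h1, legendreSym.eq_pow, map_pow, map_intCast, show (5 / 2 : ℕ) = 2 by norm_num, h2, hn, mk_absNorm_eq_pow_six hv, ← pow_mul]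
  -- the sextic symbol cubed: `≡ α^{12}`
  set μ := sexticResidueSymbol v₅ (Ideal.Quotient.mk v₅.asIdeal α) with hμ
  have hS : Ideal.Quotient.mk v₅.asIdeal (μ ^ 3) = Ideal.Quotient.mk v₅.asIdeal α ^ 12 := by
    rw [hμ, mk_sexticResidueSymbol_pow_three hζ6 h2₅ h3₅ hα0, residueCard_eq_of_five_mem hv]
    norm_num
  -- both are `±1`, congruent mod `5`, hence equal
  have hL : legendreSym 5 n = 1 ∨ legendreSym 5 n = -1 := legendreSym.eq_one_or_neg_one 5 hn5
  have hM : μ ^ 3 = 1 ∨ μ ^ 3 = -1 := sexticResidueSymbol_pow_three_eq_one_or hζ6 h2₅ h3₅ hα0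
  have hne : Ideal.Quotient.mk v₅.asIdeal (1 : 𝓞 K3) ≠ Ideal.Quotient.mk v₅.asIdeal (-1 : 𝓞 K3) := by
    intro h
    rw [Ideal.Quotient.eq, sub_neg_eq_add, one_add_one_eq_two] at h
    exact h2₅ h
  have hEq : ((legendreSym 5 n : ℤ) : 𝓞 K3) = μ ^ 3 := by
    have hc : Ideal.Quotient.mk v₅.asIdeal ((legendreSym 5 n : ℤ) : 𝓞 K3) = Ideal.Quotient.mk v₅.asIdeal (μ ^ 3) := by
      rw [hE, hS]
    rcases hL with h | h <;> rcases hM with h' | h'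
    · rw [h, h']; push_cast; rfl
    · rw [h, h', Int.cast_one] at hc; exact absurd hc hne
    · rw [h, h', Int.cast_neg, Int.cast_one] at hc; exact absurd hc.symm hne
    · rw [h, h']; push_cast; rfl
  rw [hQR]
  calc ((legendreSym 5 n : ℤ) : ℂ) = embC (((legendreSym 5 n : ℤ) : 𝓞 K3) : K3) := by simp
    _ = embC ((μ ^ 3 : 𝓞 K3) : K3) := by rw [hEq]
    _ = embC (μ : K3) ^ 3 := by push_cast; rw [map_pow]

/-- **The sextic symbol at `(5)` commutes with conjugation: `e((τα/5)₆) = \overline{e((α/5)₆)}`** (`(5)` is `τ`-stable and `τ` acts on the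
residue field, so `(τα/5)₆ = τ((α/5)₆)` by the uniqueness in Ireland–Rosen's definition). [cite: IrelandRosen1982, Ch. 14 §2, Prop. 14.2.1] -/
theorem embC_sexticResidueSymbol_tau (α : 𝓞 K3) :
    embC ((sexticResidueSymbol v₅ (Ideal.Quotient.mk v₅.asIdeal (tau α)) : 𝓞 K3) : K3) =
      conj (embC ((sexticResidueSymbol v₅ (Ideal.Quotient.mk v₅.asIdeal α) : 𝓞 K3) : K3)) := by
  letI := Ideal.Quotient.field v₅.asIdeal
  have hζ6 := isPrimitiveRoot_neg_of_isPrimitiveRoot_three EisensteinGrossen.hζ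
  obtain ⟨h2₅, h3₅⟩ := two_three_not_mem_of_five_mem hv
  rw [← embC_tau]
  congr 2
  by_cases hα : α ∈ v₅.asIdeal
  · have h0 : Ideal.Quotient.mk v₅.asIdeal α = 0 := Ideal.Quotient.eq_zero_iff_mem.mpr hα
    have h0' : Ideal.Quotient.mk v₅.asIdeal (tau α) = 0 := Ideal.Quotient.eq_zero_iff_mem.mpr ((tau_mem_iff hv α).mpr hα)
    rw [h0, h0', sexticResidueSymbol_zero hζ6 h2₅ h3₅, map_zero]
  · have hα0 : Ideal.Quotient.mk v₅.asIdeal α ≠ 0 := fun h ↦ hα (Ideal.Quotient.eq_zero_iff_mem.mp h)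
    obtain ⟨h6, hcong⟩ := sexticResidueSymbol_spec hζ6 h2₅ h3₅ hα0
    -- `τ` on the residue field
    have hle : v₅.asIdeal ≤ Ideal.comap (tau : 𝓞 K3 ≃+* 𝓞 K3).toRingHom v₅.asIdeal := fun x hx ↦ by
      rw [Ideal.mem_comap]; exact (tau_mem_iff hv x).mpr hx
    set τbar := Ideal.quotientMap v₅.asIdeal (tau : 𝓞 K3 ≃+* 𝓞 K3).toRingHom hle with hτbar
    have hτmk : ∀ y : 𝓞 K3, Ideal.Quotient.mk v₅.asIdeal (tau y) = τbar (Ideal.Quotient.mk v₅.asIdeal y) := fun y ↦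
      (Ideal.quotientMap_mk (I := v₅.asIdeal) (f := (tau : 𝓞 K3 ≃+* 𝓞 K3).toRingHom) (H := hle) (x := y)).symm
    refine sexticResidueSymbol_eq_of_pow_six_eq_one hζ6 h2₅ h3₅ (by rw [← map_pow, h6, map_one]) ?_
    rw [hτmk, hτmk, hcong, map_pow]

end Five

end SexticTwist

end Literature.NumberTheory.EllipticCurves

end
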